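import Literature.Probability.LatticeModels.TorusBlockKernels
import HarnessLib

/-!
# Block kernels on the finite torus: the Fourier side

For `M = b·m` and a function `f` on the fine torus `(ℤ/Mℤ)^d` (think: a translation-invariant
two-point function `K(x, y) = f(x - y)`), the coarse `b`-block kernel
`k(X) = Σ_{β x' = X, β y' = 0} f(x' - y')` on `(ℤ/mℤ)^d` (vocabulary of `TorusBlockKernels`, block
membership written as `∀ i, (x' i).val / b = (X i).val`) has coarse Fourier coefficients

  `Σ_X k(X) conj χ_Q(X) = b^{-d} Σ_{p ≡ Q (mod m)} |G(p)|² f̂(p)`,   `G(p) = Σ_{δ ∈ block 0} χ_p(δ)`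

(`TorusBlock.sum_blockKernel_mul_conj_torusChar`): folding the fine momenta onto the coarse torus
(`p ↦ p mod m`, `b^d` fine momenta per coarse one) with the BLOCK FORM FACTOR `|G(p)|² ≤ b^{2d}`.
This is the kinematic identity that converts an infrared bound on the RAW structure factor `f̂`
(Gaussian domination) into a bound on the Fourier coefficients of the block kernel, i.e. on the
infrared wing `β` of the Lévy bootstrap (`TorusLevyKhintchine.levyMass_le_logBootstrap`; route
`HubbardSuperconductivity/LevyLogBootstrap`, crux `LevyTransport`, input (a)). Key lemma: the fine
character at a lifted coarse site is the coarse character of the reduced momentum,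
`χ_p(b·X) = χ_{p mod m}(X)` (`TorusBlock.torusChar_lift_eq_reduce`). Friedli–Velenik (2017) §10.4
(discrete Fourier analysis); Berg–Christensen–Ressel (1984) Ch. 4 §3. No definition is introduced;
sorry-free.
-/

noncomputable section

open Finset Complex
open scoped BigOperators ComplexConjugate Real

namespace Literature.Probability.LatticeModels

namespace TorusBlock

variable {d b m M : ℕ} [NeZero M] [NeZero m]

/-! ### Characters: fine momenta at lifted coarse sites -/

/-- **The fine character at a lifted coarse site is the coarse character of the reduced momentum**:
for `M = b·m`, `p ∈ (ℤ/Mℤ)^d` and `X ∈ (ℤ/mℤ)^d`, `χ_p(b·X) = χ_{p mod m}(X)`, where `b·X` is the fine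
vector with components `b · X_i.val` and `p mod m` the coarse momentum with components `p_i.val`
(cast into `ℤ/m`). (`e^{2πi p_i b X_i /(bm)} = e^{2πi (p_i mod m) X_i / m}`.) [folklore] -/
theorem torusChar_lift_eq_reduce (hM : M = b * m) (p : TorusSite d M) (X : TorusSite d m) :
    torusChar p (fun j => ((b * (X j).val : ℕ) : ZMod M)) =
      torusChar (fun i => (((p i).val : ℕ) : ZMod m)) X := by
  have hb : 0 < b := pos_of_eq_mul hM
  unfold torusChar
  refine Finset.prod_congr rfl fun i _ => ?_
  rw [stdAddChar_mul_eq_exp, stdAddChar_mul_eq_exp]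
  have hliftval : (((b * (X i).val : ℕ) : ZMod M)).val = b * (X i).val := by
    apply ZMod.val_natCast_of_lt
    rw [hM]
    exact (Nat.mul_lt_mul_left hb).2 (ZMod.val_lt (X i))
  have hredval : ((((p i).val : ℕ) : ZMod m)).val = (p i).val % m := ZMod.val_natCast _ _
  rw [hliftval, hredval]
  -- `p_i.val = m * q + r`, `r = p_i.val % m`
  set q : ℕ := (p i).val / m with hq
  set r : ℕ := (p i).val % m with hr
  have hdecomp : (p i).val = m * q + r := (Nat.div_add_mod _ _).symm
  have hM0 : (M : ℂ) ≠ 0 := Nat.cast_ne_zero.2 (NeZero.ne M)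
  have hm0 : (m : ℂ) ≠ 0 := Nat.cast_ne_zero.2 (NeZero.ne m)
  have hb0 : (b : ℂ) ≠ 0 := Nat.cast_ne_zero.2 hb.ne'
  have key : (2 * π * I * (((p i).val * (b * (X i).val) : ℕ) : ℝ) / M : ℂ) =
      2 * π * I * ((r * (X i).val : ℕ) : ℝ) / m + (q * (X i).val : ℕ) * (2 * π * I) := by
    rw [hdecomp, hM]
    push_cast
    field_simp
    ring
  rw [key, Complex.exp_add]
  have hper : Complex.exp (((q * (X i).val : ℕ) : ℂ) * (2 * π * I)) = 1 := by
    have := Complex.exp_int_mul_two_pi_mul_I ((q * (X i).val : ℕ) : ℤ)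
    exact_mod_cast this
  rw [hper, mul_one]

/-- **Orthogonality of the coarse characters**, product form:
`Σ_X χ_P(X) conj χ_Q(X) = m^d 𝟙{P = Q}`. [folklore] -/
theorem sum_torusChar_mul_conj (P Q : TorusSite d m) :
    ∑ X : TorusSite d m, torusChar P X * conj (torusChar Q X) =
      if P = Q then (m : ℂ) ^ d else 0 := by
  have h : ∀ X : TorusSite d m, torusChar P X * conj (torusChar Q X) = torusChar (P - Q) X :=
    fun X => (torusChar_sub_left P Q X).symm
  simp_rw [h, sum_torusChar_right, sub_eq_zero]

/-- **Shifting a block sum to the origin block**: `Σ_{x' ∈ block X} g(x') = Σ_{δ ∈ block 0} g(δ + b·X)`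
(block membership as an indicator; `β (δ + b·X) = β δ + X`, `TorusBlock.coarse_add_lift`). [folklore] -/
theorem sum_ite_block_eq_sum_ite_block_zero (hM : M = b * m) (g : TorusSite d M → ℂ)
    (X : TorusSite d m) :
    ∑ x' : TorusSite d M, (if (∀ i : Fin d, (x' i).val / b = (X i).val) then g x' else 0) =
      ∑ δ : TorusSite d M, (if (∀ i : Fin d, (δ i).val / b = 0) then
        g (δ + fun j => ((b * (X j).val : ℕ) : ZMod M)) else 0) := by
  classical
  set w : TorusSite d M := fun j => ((b * (X j).val : ℕ) : ZMod M) with hw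
  rw [← Equiv.sum_comp (Equiv.addRight w)]
  refine Finset.sum_congr rfl fun δ _ => ?_
  have hcond : (∀ i : Fin d, ((Equiv.addRight w δ) i).val / b = (X i).val) ↔
      (∀ i : Fin d, (δ i).val / b = 0) := by
    rw [Equiv.coe_addRight, block_iff_coarse_eq' hM (δ + w) X, hw, coarse_add_lift hM δ X,
      add_eq_right]
    have := block_iff_coarse_eq' hM δ (0 : TorusSite d m)
    simp only [Pi.zero_apply, ZMod.val_zero] at this
    exact this.symm
  rw [if_congr hcond rfl rfl]
  rfl

/-! ### The coarse Fourier coefficients of a block kernel -/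

/-- Swapping a double sum past a third one: `Σ_a Σ_b Σ_c F = Σ_c Σ_a Σ_b F`. [folklore] -/
theorem sum_sum_sum_comm {α β γ : Type*} (s : Finset α) (t : Finset β) (u : Finset γ)
    (F : α → β → γ → ℂ) :
    ∑ a ∈ s, ∑ x ∈ t, ∑ c ∈ u, F a x c = ∑ c ∈ u, ∑ a ∈ s, ∑ x ∈ t, F a x c := by
  calc ∑ a ∈ s, ∑ x ∈ t, ∑ c ∈ u, F a x c = ∑ a ∈ s, ∑ c ∈ u, ∑ x ∈ t, F a x c :=
        Finset.sum_congr rfl fun a _ => Finset.sum_comm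
    _ = ∑ c ∈ u, ∑ a ∈ s, ∑ x ∈ t, F a x c := Finset.sum_comm

/-- **The coarse Fourier coefficients of a block kernel (block form factor).** For `M = b·m`,
`f : (ℤ/Mℤ)^d → ℂ` and a coarse momentum `Q ∈ (ℤ/mℤ)^d`, the `b`-block kernel
`k(X) = Σ_{β x' = X, β y' = 0} f(x' - y')` satisfies
`Σ_X k(X) conj χ_Q(X) = b^{-d} Σ_{p : p mod m = Q} G(p) conj G(p) · f̂(p)` with the block form factor
`G(p) = Σ_{δ ∈ block 0} χ_p(δ)` and `f̂ = torusFourier f`: the `b^d` fine momenta `p ≡ Q (mod m)`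
fold onto the coarse momentum `Q`. (Expand `f` by Fourier inversion, shift the block sum to the
origin block, use `χ_p(b·X) = χ_{p mod m}(X)` and the orthogonality of the coarse characters.)
Friedli–Velenik (2017) §10.4. [folklore] -/
theorem sum_blockKernel_mul_conj_torusChar (hM : M = b * m) (f : TorusSite d M → ℂ)
    (Q : TorusSite d m) :
    ∑ X : TorusSite d m, (∑ x' : TorusSite d M, ∑ y' : TorusSite d M,
        if (∀ i : Fin d, (x' i).val / b = (X i).val) ∧ (∀ i : Fin d, (y' i).val / b = 0)
        then f (x' - y') else 0) * conj (torusChar Q X) =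
      ((b : ℂ) ^ d)⁻¹ *
        ∑ p ∈ univ.filter (fun p : TorusSite d M => (fun i => (((p i).val : ℕ) : ZMod m)) = Q),
          ((∑ δ : TorusSite d M, if (∀ i : Fin d, (δ i).val / b = 0) then torusChar p δ else 0) *
            conj (∑ δ : TorusSite d M,
              if (∀ i : Fin d, (δ i).val / b = 0) then torusChar p δ else 0)) *
          torusFourier f p := by
  classical
  have hb : 0 < b := pos_of_eq_mul hM
  -- notation
  set w : TorusSite d m → TorusSite d M := fun X j => ((b * (X j).val : ℕ) : ZMod M) with hw
  set red : TorusSite d M → TorusSite d m := fun p i => (((p i).val : ℕ) : ZMod m) with hred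
  set B0 : Finset (TorusSite d M) := univ.filter (fun δ : TorusSite d M => ∀ i : Fin d, (δ i).val / b = 0)
    with hB0
  set G : TorusSite d M → ℂ := fun p => ∑ δ ∈ B0, torusChar p δ with hG
  set fhat : TorusSite d M → ℂ := torusFourier f with hfhat
  have hGite : ∀ p, (∑ δ : TorusSite d M, if (∀ i : Fin d, (δ i).val / b = 0) then torusChar p δ else 0)
      = G p := fun p => by simp only [hG, hB0, Finset.sum_filter]
  have hGconj : ∀ p, conj (G p) = ∑ δ ∈ B0, conj (torusChar p δ) := fun p => by
    rw [hG, map_sum]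
  -- Fourier inversion of `f`
  have hinv : ∀ z : TorusSite d M, f z = ((M : ℂ) ^ d)⁻¹ * ∑ p, fhat p * torusChar p z := by
    intro z
    have := congrFun (torusFourier_inversion_holds (d := d) (L := M) f) z
    rw [← this, torusFourierInv_eq_sum_torusChar]
  -- the expansion of `f (δ + w X - y')`
  have hexp : ∀ (X : TorusSite d m) (δ y' : TorusSite d M),
      f (δ + w X - y') = ((M : ℂ) ^ d)⁻¹ *
        ∑ p, fhat p * (torusChar p δ * torusChar (red p) X * conj (torusChar p y')) := by
    intro X δ y'
    rw [hinv]
    congr 1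
    refine Finset.sum_congr rfl fun p _ => ?_
    rw [torusChar_sub_right, torusChar_add_right, hw, torusChar_lift_eq_reduce hM p X]
  -- the block kernel at `X`, as a sum over the origin block twice
  have hS : ∀ X : TorusSite d m, (∑ x' : TorusSite d M, ∑ y' : TorusSite d M,
        if (∀ i : Fin d, (x' i).val / b = (X i).val) ∧ (∀ i : Fin d, (y' i).val / b = 0)
        then f (x' - y') else 0) =
      ((M : ℂ) ^ d)⁻¹ * ∑ p, fhat p * (G p * conj (G p)) * torusChar (red p) X := by
    intro X
    -- (E1) indicator sums → sums over `B0`, shifted to the origin block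
    have h1 : (∑ x' : TorusSite d M, ∑ y' : TorusSite d M,
        if (∀ i : Fin d, (x' i).val / b = (X i).val) ∧ (∀ i : Fin d, (y' i).val / b = 0)
        then f (x' - y') else 0) =
        ∑ x' : TorusSite d M, (if (∀ i : Fin d, (x' i).val / b = (X i).val) then
          ∑ y' ∈ B0, f (x' - y') else 0) := by
      refine Finset.sum_congr rfl fun x' _ => ?_
      by_cases hx : ∀ i : Fin d, (x' i).val / b = (X i).val
      · rw [if_pos hx, hB0, Finset.sum_filter]
        exact Finset.sum_congr rfl fun y' _ => by rw [if_congr (and_iff_right hx) rfl rfl]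
      · rw [if_neg hx]
        exact Finset.sum_eq_zero fun y' _ => by rw [if_neg (fun h => hx h.1)]
    rw [h1, sum_ite_block_eq_sum_ite_block_zero hM (fun x' => ∑ y' ∈ B0, f (x' - y')) X,
      ← Finset.sum_filter, ← hB0]
    -- (E2) expand `f`
    have h2 : ∑ δ ∈ B0, ∑ y' ∈ B0, f (δ + (fun j => ((b * (X j).val : ℕ) : ZMod M)) - y') =
        ∑ δ ∈ B0, ∑ y' ∈ B0, ((M : ℂ) ^ d)⁻¹ *
          ∑ p, fhat p * (torusChar p δ * torusChar (red p) X * conj (torusChar p y')) :=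
      Finset.sum_congr rfl fun δ _ => Finset.sum_congr rfl fun y' _ => hexp X δ y'
    rw [h2]
    -- (E3) resum
    simp_rw [← Finset.mul_sum]
    congr 1
    rw [sum_sum_sum_comm]
    refine Finset.sum_congr rfl fun p _ => ?_
    rw [hG, hGconj, Finset.sum_mul_sum, Finset.mul_sum, Finset.sum_mul]
    refine Finset.sum_congr rfl fun δ _ => ?_
    rw [Finset.mul_sum, Finset.sum_mul]
    refine Finset.sum_congr rfl fun y' _ => ?_
    ring
  -- sum over `X` against `conj χ_Q`: orthogonality of the coarse characters
  simp_rw [hS, hGite]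
  calc ∑ X : TorusSite d m, ((M : ℂ) ^ d)⁻¹ *
          (∑ p, fhat p * (G p * conj (G p)) * torusChar (red p) X) * conj (torusChar Q X)
      = ((M : ℂ) ^ d)⁻¹ * ∑ p, fhat p * (G p * conj (G p)) *
          ∑ X : TorusSite d m, torusChar (red p) X * conj (torusChar Q X) := by
        have hL : ∀ X : TorusSite d m, ((M : ℂ) ^ d)⁻¹ *
            (∑ p, fhat p * (G p * conj (G p)) * torusChar (red p) X) * conj (torusChar Q X) =
            ∑ p, ((M : ℂ) ^ d)⁻¹ * (fhat p * (G p * conj (G p))) *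
              (torusChar (red p) X * conj (torusChar Q X)) := fun X => by
          rw [Finset.mul_sum, Finset.sum_mul]
          exact Finset.sum_congr rfl fun p _ => by ring
        simp_rw [hL]
        rw [Finset.sum_comm, Finset.mul_sum]
        refine Finset.sum_congr rfl fun p _ => ?_
        rw [Finset.mul_sum, Finset.mul_sum]
        exact Finset.sum_congr rfl fun X _ => by ring
    _ = ((M : ℂ) ^ d)⁻¹ * ∑ p, fhat p * (G p * conj (G p)) *
          (if red p = Q then (m : ℂ) ^ d else 0) := by
        simp_rw [sum_torusChar_mul_conj]
    _ = ((M : ℂ) ^ d)⁻¹ * ((m : ℂ) ^ d *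
          ∑ p ∈ univ.filter (fun p : TorusSite d M => red p = Q), fhat p * (G p * conj (G p))) := by
        congr 1
        rw [Finset.mul_sum, Finset.sum_filter]
        refine Finset.sum_congr rfl fun p _ => ?_
        split_ifs <;> ring
    _ = ((b : ℂ) ^ d)⁻¹ *
          ∑ p ∈ univ.filter (fun p : TorusSite d M => red p = Q), (G p * conj (G p)) * fhat p := by
        have hM0 : ((M : ℂ) ^ d) ≠ 0 := pow_ne_zero _ (Nat.cast_ne_zero.2 (NeZero.ne M))
        have hm0 : ((m : ℂ) ^ d) ≠ 0 := pow_ne_zero _ (Nat.cast_ne_zero.2 (NeZero.ne m))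
        have hb0 : ((b : ℂ) ^ d) ≠ 0 := pow_ne_zero _ (Nat.cast_ne_zero.2 hb.ne')
        have hMbm : ((M : ℂ) ^ d) = (b : ℂ) ^ d * (m : ℂ) ^ d := by
          rw [hM]; push_cast; ring
        rw [← mul_assoc, hMbm, mul_inv, mul_assoc ((b:ℂ)^d)⁻¹, inv_mul_cancel₀ hm0, mul_one]
        congr 1
        exact Finset.sum_congr rfl fun p _ => by ring

/-- **The block form factor is at most `b^d` in modulus**: `G(p) conj G(p) = ‖G(p)‖²` with
`‖G(p)‖ ≤ #block(0) = b^d` (`TorusBlock.card_filter_block`). [folklore] -/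
theorem blockFormFactor_mul_conj_eq (hM : M = b * m) (p : TorusSite d M) :
    (∑ δ : TorusSite d M, if (∀ i : Fin d, (δ i).val / b = 0) then torusChar p δ else 0) *
        conj (∑ δ : TorusSite d M, if (∀ i : Fin d, (δ i).val / b = 0) then torusChar p δ else 0) =
      ((‖∑ δ : TorusSite d M, if (∀ i : Fin d, (δ i).val / b = 0) then torusChar p δ else 0‖ ^ 2 : ℝ) : ℂ) ∧
    ‖∑ δ : TorusSite d M, if (∀ i : Fin d, (δ i).val / b = 0) then torusChar p δ else 0‖ ≤ (b : ℝ) ^ d := by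
  classical
  refine ⟨by rw [Complex.mul_conj, Complex.normSq_eq_norm_sq], ?_⟩
  calc ‖∑ δ : TorusSite d M, if (∀ i : Fin d, (δ i).val / b = 0) then torusChar p δ else 0‖
      ≤ ∑ δ : TorusSite d M, ‖if (∀ i : Fin d, (δ i).val / b = 0) then torusChar p δ else 0‖ :=
        norm_sum_le _ _
    _ = ∑ δ : TorusSite d M, (if (∀ i : Fin d, (δ i).val / b = ((0 : TorusSite d m) i).val) then (1:ℝ) else 0) := by
        refine Finset.sum_congr rfl fun δ _ => ?_
        simp only [Pi.zero_apply, ZMod.val_zero]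
        split_ifs <;> simp
    _ = (b : ℝ) ^ d := by
        rw [Finset.sum_boole, card_filter_block hM (0 : TorusSite d m)]
        push_cast
        ring

/-- **Coarse Fourier coefficients of a block kernel, real form with the form-factor bound.** For
`M = b·m`, a REAL function `f` on `(ℤ/Mℤ)^d` and a coarse momentum `Q` such that the cosine Fourier
coefficients `Σ_x f(x) Re χ_p(x)` are nonnegative at the `b^d` fine momenta `p ≡ Q (mod m)`:
`Σ_X k(X) Re χ_Q(X) ≤ b^d · Σ_{p ≡ Q (mod m)} Σ_x f(x) Re χ_p(x)` — the coarse structure factor of the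
block kernel is at most `b^d` times the folded fine structure factor (`|G(p)|² ≤ b^{2d}`). With `f`
the transverse two-point function this turns an infrared bound on the raw structure factor into a
bound on the infrared wing `β` of the block Lévy bootstrap. [folklore] -/
theorem sum_blockKernel_mul_re_torusChar_le (hM : M = b * m) (f : TorusSite d M → ℝ)
    (Q : TorusSite d m)
    (hpos : ∀ p : TorusSite d M, (fun i => (((p i).val : ℕ) : ZMod m)) = Q →
      0 ≤ ∑ x : TorusSite d M, f x * (torusChar p x).re) :
    ∑ X : TorusSite d m, (∑ x' : TorusSite d M, ∑ y' : TorusSite d M,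
        if (∀ i : Fin d, (x' i).val / b = (X i).val) ∧ (∀ i : Fin d, (y' i).val / b = 0)
        then f (x' - y') else 0) * (torusChar Q X).re ≤
      (b : ℝ) ^ d * ∑ p ∈ univ.filter (fun p : TorusSite d M => (fun i => (((p i).val : ℕ) : ZMod m)) = Q),
        ∑ x : TorusSite d M, f x * (torusChar p x).re := by
  classical
  have hb : 0 < b := pos_of_eq_mul hM
  have hbpos : (0 : ℝ) < (b : ℝ) ^ d := pow_pos (Nat.cast_pos.2 hb) d
  have hmain := sum_blockKernel_mul_conj_torusChar hM (fun z => (f z : ℂ)) Q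
  -- real parts: left-hand side
  have hkreal : ∀ X : TorusSite d m, (∑ x' : TorusSite d M, ∑ y' : TorusSite d M,
      if (∀ i : Fin d, (x' i).val / b = (X i).val) ∧ (∀ i : Fin d, (y' i).val / b = 0)
      then ((f (x' - y') : ℝ) : ℂ) else 0) =
      ((∑ x' : TorusSite d M, ∑ y' : TorusSite d M,
        if (∀ i : Fin d, (x' i).val / b = (X i).val) ∧ (∀ i : Fin d, (y' i).val / b = 0)
        then f (x' - y') else 0 : ℝ) : ℂ) := fun X => by
    push_cast
    refine Finset.sum_congr rfl fun x' _ => Finset.sum_congr rfl fun y' _ => ?_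
    split_ifs <;> simp
  have hL : (∑ X : TorusSite d m, (∑ x' : TorusSite d M, ∑ y' : TorusSite d M,
        if (∀ i : Fin d, (x' i).val / b = (X i).val) ∧ (∀ i : Fin d, (y' i).val / b = 0)
        then ((f (x' - y') : ℝ) : ℂ) else 0) * conj (torusChar Q X)).re =
      ∑ X : TorusSite d m, (∑ x' : TorusSite d M, ∑ y' : TorusSite d M,
        if (∀ i : Fin d, (x' i).val / b = (X i).val) ∧ (∀ i : Fin d, (y' i).val / b = 0)
        then f (x' - y') else 0) * (torusChar Q X).re := by
    rw [Complex.re_sum]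
    refine Finset.sum_congr rfl fun X _ => ?_
    rw [hkreal X, Complex.re_ofReal_mul, Complex.conj_re]
  -- real parts: right-hand side
  set S : Finset (TorusSite d M) :=
    univ.filter (fun p : TorusSite d M => (fun i => (((p i).val : ℕ) : ZMod m)) = Q) with hS
  set G : TorusSite d M → ℂ := fun p =>
    ∑ δ : TorusSite d M, if (∀ i : Fin d, (δ i).val / b = 0) then torusChar p δ else 0 with hG
  have hR : (((b : ℂ) ^ d)⁻¹ * ∑ p ∈ S, (G p * conj (G p)) * torusFourier (fun z => (f z : ℂ)) p).re =
      ((b : ℝ) ^ d)⁻¹ * ∑ p ∈ S, ‖G p‖ ^ 2 * ∑ x : TorusSite d M, f x * (torusChar p x).re := by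
    have hc : ((b : ℂ) ^ d)⁻¹ = ((((b : ℝ) ^ d)⁻¹ : ℝ) : ℂ) := by push_cast; rfl
    rw [hc, Complex.re_ofReal_mul, Complex.re_sum]
    congr 1
    refine Finset.sum_congr rfl fun p _ => ?_
    rw [(blockFormFactor_mul_conj_eq hM p).1, Complex.re_ofReal_mul, torusFourier_ofReal_re_eq]
  have hEq : ∑ X : TorusSite d m, (∑ x' : TorusSite d M, ∑ y' : TorusSite d M,
        if (∀ i : Fin d, (x' i).val / b = (X i).val) ∧ (∀ i : Fin d, (y' i).val / b = 0)
        then f (x' - y') else 0) * (torusChar Q X).re =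
      ((b : ℝ) ^ d)⁻¹ * ∑ p ∈ S, ‖G p‖ ^ 2 * ∑ x : TorusSite d M, f x * (torusChar p x).re := by
    rw [← hL, hmain, hR]
  rw [hEq]
  -- bound the form factor by `b^d`
  have hGle : ∀ p, ‖G p‖ ^ 2 ≤ ((b : ℝ) ^ d) ^ 2 := fun p => by
    have h := (blockFormFactor_mul_conj_eq hM p).2
    exact pow_le_pow_left₀ (norm_nonneg _) h 2
  calc ((b : ℝ) ^ d)⁻¹ * ∑ p ∈ S, ‖G p‖ ^ 2 * ∑ x : TorusSite d M, f x * (torusChar p x).re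
      ≤ ((b : ℝ) ^ d)⁻¹ * ∑ p ∈ S, ((b : ℝ) ^ d) ^ 2 * ∑ x : TorusSite d M, f x * (torusChar p x).re := by
        refine mul_le_mul_of_nonneg_left (Finset.sum_le_sum fun p hp => ?_) (inv_nonneg.2 hbpos.le)
        exact mul_le_mul_of_nonneg_right (hGle p) (hpos p (Finset.mem_filter.1 hp).2)
    _ = (b : ℝ) ^ d * ∑ p ∈ S, ∑ x : TorusSite d M, f x * (torusChar p x).re := by
        rw [← Finset.mul_sum, ← mul_assoc]
        congr 1
        field_simp

end TorusBlock

end Literature.Probability.LatticeModels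

end
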